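import Summits.BirchSwinnertonDyer.Rank1Residual.P2.CongruentNumberSilentEvenFiveEnclosureMonskyEven
import Summits.BirchSwinnertonDyer.Rank1Residual.P2.CongruentNumberSilentEvenFiveEnclosureGenus
import Literature.NumberTheory.EllipticCurves.Tian2014.CMPointSystemGrossZagierSplit
import HarnessLib

/-!
# Cell «bsd-monsky» (typer): THE ENCLOSURE RELATIVE TO THE SPLIT SYSTEM FACT — C-P2-1 from `hMe` (or `h515`) and
# `tian2014_system_sMinus_split` (Tian Thm. 2.8 system ∧ TYZ Thm. 3.3 at `χ₀` AS PRINTED ∧ the bridge Lemma 8.1 as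
# ONE displayed sentence ∧ Gauss genus theory)

HONEST FRAMING: nothing asserted; conditional on the displayed fact `hSys″` (`Tian2014.tian2014_system_sMinus_split`)
and on `hMe` (Heath-Brown 1994, Appendix (Monsky), even case, printed as a sketch proof, pp. 368–369; a named fact)
resp. `h515` (Monsky 1990 Cor. 5.15 with Remark (2)). Compared with the landed genus form (`…EnclosureGenus.lean`,
`…EnclosureMonskyEven.lean`), the Gross–Zagier index relation is no longer ONE flagged predicate: TYZ Thm. 3.3 at `χ₀`
is displayed as printed, the `2`-rank `h₂ = 2` and the `2`-adic bookkeeping are kernel theorems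
(`Tian2014/CMPointSystemGrossZagierSplit.lean`), and the (B4) flag sits on the single displayed sentence
`CMPointData.bridgeLemma81` («`R_{χ₀} = ±2y + torsion`», PROOF-A v3.4 Lemma 8.1). One-line compositions; nothing booked.
-/

noncomputable section

open scoped Classical

open Literature.NumberTheory.EllipticCurves.Monsky1990

set_option autoImplicit false

namespace Summit.BirchSwinnertonDyer.Rank1Residual.P2

open Conjectures Literature.NumberTheory.EllipticCurves.Tian2014
  Literature.NumberTheory.EllipticCurves.HeathBrown1994

/-- **C-P2-1 relative to Heath-Brown 1994's Selmer count and the SPLIT system fact** (no Cor 5.15). Sorry-free;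
nothing asserted. [cite: HeathBrown1994SelmerCongruentII, Appendix (Monsky)] [cite: Tian2014, Thm. 2.8 (J132), Notations (J122–123)]
[cite: TianYuanZhang2017, Thm. 3.3 (p. 739)] [cite: Miller2011LMS, Def. 1.1] -/
theorem congruentSilentEvenFiveBSDTwo_of_splitSystem_of_monskyEven (hMe : monsky_card_selmerGroup_two_even)
    (hSys : tian2014_system_sMinus_split) : CongruentSilentEvenFiveBSDTwo :=
  congruentSilentEvenFiveBSDTwo_of_genusSystem_of_monskyEven hMe (tian2014_system_sMinus_genus_of_split hSys)

/-- **C-P2-1 relative to Monsky 1990 Cor. 5.15 and the SPLIT system fact.** Sorry-free; nothing asserted.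
[cite: Monsky1990MockHeegner, Cor. 5.15 (p. 66), Remark (2) (p. 67)] [cite: Tian2014, Thm. 2.8 (J132), Notations (J122–123)]
[cite: TianYuanZhang2017, Thm. 3.3 (p. 739)] [cite: Miller2011LMS, Def. 1.1] -/
theorem congruentSilentEvenFiveBSDTwo_of_splitSystem
    (h515 : cor515_rank_eq_one_and_card_selmerGroup_two) (hSys : tian2014_system_sMinus_split) :
    CongruentSilentEvenFiveBSDTwo :=
  congruentSilentEvenFiveBSDTwo_of_genusSystem h515 (tian2014_system_sMinus_genus_of_split hSys)

end Summit.BirchSwinnertonDyer.Rank1Residual.P2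

end
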